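import Literature.MathematicalPhysics.QuantumFieldTheory.Balaban1983to89.B12Eq213Body268

/-!
# `Balaban1983to89.B12Eq213SecondDifference` — T. Bałaban, *Renormalization group approach to lattice gauge field theories. I*,
Commun. Math. Phys. **109** (1987) 249–301 [Balaban1987RG1], (2.13) p. 268 with p. 263 ll. 22–28 and p. 256 ∕ p. 298: **the COMPARISON
PRINCIPLE AT SECOND ORDER for the (2.13) new term, VERTEX-FREE — for three exponents `F₋, F₀, F₊` on the small-field support with
`|F₊ − 2F₀ + F₋| ≤ s₂` and `|F₀ − F₋| ≤ s₁`: `|log∫χe^{F₊} − 2log∫χe^{F₀} + log∫χe^{F₋}| ≤ s₂ + 2s₁²` — hence the SECOND DIFFERENCES of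
`𝐄^{(k+1)}` in its own coupling (three couplings) and in an older coupling (three old actions in the curly bracket), kernel-checked on
the body of record**

statement-level skeleton of published theorems with citation tags; proofs where landed; nothing here is a claim about
the Yang–Mills mass gap

PDF held: `paper:balaban1987-cmp109-rg-i-small-field` (journal page = PDF page + 248); pp. 256, 263, 268, 298 re-read this session.

CITATION HEADER / WHAT IS REPRODUCED (cell `pub-ymgap`, HUMAN RULING D-0062 Track A, seat `pub-ymgap-dag-n22-b` = the
FIRST-MISSING-ESTIMATE seat of DAG node N22 = NE9; eleventh module of the body-level chain, answering the twin seat's map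
[DAGN22A-G0-COORD-1] (pub-ymgap INBOX l.9434): the -a knit's road 2 (`Summits/…/BalabanUVNodesN22KnitRecursion.secondDiff_of_stepSecondDiff`)
consumes exactly two VERTEX-FREE body-shaped inputs — (S2-last) second differences of the new term in its own coupling, (S2-old) the
second-order step inequality in an older coupling through three old actions; a NEW LEAF over r20's `B12Eq213Body268`, nothing modified).

THE PRINT.  p. 263 ll. 22–28 *«C^∞-function of g_{j−1}»*; p. 256 ∕ p. 298 (history dependence in words); (2.13) p. 268.  NOTHING
quantitative printed at any order.

WHAT THIS MODULE DOES (THEOREMS ONLY; no definition, no named fact).  The new term is `Λ(F) = log ∫ χ e^{F} dμ`, a CONVEX, 1-Lipschitz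
functional of the exponent on the support of `χ`; at second order this gives, with NO derivatives (vertex-free) and NO integrability beyond
the three integrands:
* §1 **`abs_secondDiff_log_integral_le`** (raw, over any probability space): `|Λ(F₊) − 2Λ(F₀) + Λ(F₋)| ≤ s₂ + 2s₁²` for
  `|F₊ − 2F₀ + F₋| ≤ s₂`, `|F₀ − F₋| ≤ s₁` on supp χ — by SYMMETRISATION over `μ × μ`: pointwise
  `2e^{−s₂}w₁w₂ ≤ χ₁χ₂(e^{F₊(1)+F₋(2)} + e^{F₋(1)+F₊(2)}) ≤ 2e^{s₂}cosh(2s₁)w₁w₂` (`w = χe^{F₀}`; AM–GM below, `cosh` monotonicity above),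
  hence `e^{−s₂}I₀² ≤ I₊I₋ ≤ e^{s₂}cosh(2s₁)I₀²`, and `log cosh(2s₁) ≤ 2s₁²` (Mathlib `Real.cosh_le_exp_half_sq`).
* §2 on the body: **`abs_secondDiff_newTerm_coupling_le`** — (S2-last): three couplings `g₋, g₀, g₊` of the SAME datum,
  `|𝐄^{(k+1)}(g₊,U) − 2𝐄^{(k+1)}(g₀,U) + 𝐄^{(k+1)}(g₋,U)| ≤ s₂ + 2s₁²` from the first∕second differences of the exponent on supp χ_U (with a
  C² exponent: `s₁ = L₁d`, `s₂ = L₂d²` ⇒ `≤ (L₂ + 2L₁²)d²`, matching `B12Eq213SecondOrderCoupling` without derivatives);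
  **`abs_secondDiff_newTerm_withQ_le`** — (S2-old): three curly brackets `{…}₋, {…}₀, {…}₊` (three old actions) at the same coupling,
  `|𝐄₊ − 2𝐄₀ + 𝐄₋| ≤ s₂ + 2s₁²` from `|{…}₊ − 2{…}₀ + {…}₋| ≤ s₂`, `|{…}₀ − {…}₋| ≤ s₁` on supp χ_U — the body-level second-order STEP
  inequality: «linear channel `s₂` + variance channel `2s₁²`».
HONEST READING: un-localised, body-level; the localized versions with `e^{−κd_j(X)}` and per-creation-step weights are W1's.

HONEST FRAMING: count-neutral Track-A side module; NOT a discharge of node N22; one finite T⁴ programme at fixed ε, Bałaban AS PRINTED with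
locators; nothing continuum ∕ ℝ⁴ ∕ OS ∕ mass-gap ∕ Clay.
-/

noncomputable section

namespace Literature.MathematicalPhysics.QuantumFieldTheory.Balaban1983to89.B12Eq213SecondDifference

open _root_.MeasureTheory
open scoped BigOperators
open Literature.MathematicalPhysics.QuantumFieldTheory.Balaban1983to89
open Literature.MathematicalPhysics.QuantumFieldTheory.Balaban1983to89.B12Eq213Body268 (FluctData)

/-! ## §1. Engine: the symmetrised product bounds on `Ω × Ω` -/

section Raw

variable {Ω : Type*} [MeasurableSpace Ω] {μ : Measure Ω} [IsProbabilityMeasure μ]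

/-- AM–GM for exponentials: `2e^{(A+B)/2} ≤ e^{A} + e^{B}`. [folklore] -/
private theorem two_exp_half_le (A B : ℝ) : 2 * Real.exp ((A + B) / 2) ≤ Real.exp A + Real.exp B := by
  have hA : Real.exp A = Real.exp (A / 2) ^ 2 := by rw [sq, ← Real.exp_add]; ring_nf
  have hB : Real.exp B = Real.exp (B / 2) ^ 2 := by rw [sq, ← Real.exp_add]; ring_nf
  have hM : Real.exp ((A + B) / 2) = Real.exp (A / 2) * Real.exp (B / 2) := by rw [← Real.exp_add]; ring_nf
  rw [hA, hB, hM]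
  nlinarith [sq_nonneg (Real.exp (A / 2) - Real.exp (B / 2))]

/-- **SECOND DIFFERENCES OF `log ∫ χ e^{F}` — VERTEX-FREE**: for `0 ≤ χ`, three exponents with `|F₊ − 2F₀ + F₋| ≤ s₂` and
`|F₀ − F₋| ≤ s₁` on the support of `χ`, the three integrands integrable and the middle integral positive:
`|log∫χe^{F₊} − 2log∫χe^{F₀} + log∫χe^{F₋}| ≤ s₂ + 2s₁²`.  Proof by SYMMETRISATION over the product measure: pointwise on
`Ω × Ω`, `e^{−s₂}·2w₁w₂ ≤ χ₁χ₂(e^{F₊(1)+F₋(2)} + e^{F₋(1)+F₊(2)}) ≤ e^{s₂}cosh(2s₁)·2w₁w₂` (`w = χe^{F₀}`; AM–GM below, `cosh` above), hence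
`e^{−s₂}I₀² ≤ I₊I₋ ≤ e^{s₂}cosh(2s₁)I₀²`, and `log cosh(2s₁) ≤ 2s₁²`.  (`Λ(F) = log∫χe^{F}` is convex and 1-Lipschitz on the support —
the second-order twin of the comparison engine of `B12Eq213CouplingDependence`.) [cite: Balaban1987RG1, (2.13) p.268 and p.263 (clause before (1.18))] -/
theorem abs_secondDiff_log_integral_le {χ Fm F₀ Fp : Ω → ℝ} {s₁ s₂ : ℝ} (h0 : ∀ ω, 0 ≤ χ ω)
    (him : Integrable (fun ω => χ ω * Real.exp (Fm ω)) μ) (hi0 : Integrable (fun ω => χ ω * Real.exp (F₀ ω)) μ)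
    (hip : Integrable (fun ω => χ ω * Real.exp (Fp ω)) μ) (hpos : 0 < ∫ ω, χ ω * Real.exp (F₀ ω) ∂μ)
    (h1 : ∀ ω, χ ω ≠ 0 → |F₀ ω - Fm ω| ≤ s₁) (h2 : ∀ ω, χ ω ≠ 0 → |Fp ω - 2 * F₀ ω + Fm ω| ≤ s₂) :
    |Real.log (∫ ω, χ ω * Real.exp (Fp ω) ∂μ) - 2 * Real.log (∫ ω, χ ω * Real.exp (F₀ ω) ∂μ)
        + Real.log (∫ ω, χ ω * Real.exp (Fm ω) ∂μ)| ≤ s₂ + 2 * s₁ ^ 2 := by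
  set I₀ := ∫ ω, χ ω * Real.exp (F₀ ω) ∂μ with hI₀
  set Ip := ∫ ω, χ ω * Real.exp (Fp ω) ∂μ with hIp
  set Im := ∫ ω, χ ω * Real.exp (Fm ω) ∂μ with hIm
  -- product-measure representations
  have hPM : Ip * Im = ∫ z, (χ z.1 * Real.exp (Fp z.1)) * (χ z.2 * Real.exp (Fm z.2)) ∂(μ.prod μ) :=
    (integral_prod_mul _ _).symm
  have hMP : Im * Ip = ∫ z, (χ z.1 * Real.exp (Fm z.1)) * (χ z.2 * Real.exp (Fp z.2)) ∂(μ.prod μ) :=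
    (integral_prod_mul _ _).symm
  have h00 : I₀ * I₀ = ∫ z, (χ z.1 * Real.exp (F₀ z.1)) * (χ z.2 * Real.exp (F₀ z.2)) ∂(μ.prod μ) :=
    (integral_prod_mul _ _).symm
  have hIpm : Integrable (fun z : Ω × Ω => (χ z.1 * Real.exp (Fp z.1)) * (χ z.2 * Real.exp (Fm z.2))) (μ.prod μ) :=
    hip.mul_prod him
  have hImp : Integrable (fun z : Ω × Ω => (χ z.1 * Real.exp (Fm z.1)) * (χ z.2 * Real.exp (Fp z.2))) (μ.prod μ) :=
    him.mul_prod hip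
  have hI00 : Integrable (fun z : Ω × Ω => (χ z.1 * Real.exp (F₀ z.1)) * (χ z.2 * Real.exp (F₀ z.2))) (μ.prod μ) :=
    hi0.mul_prod hi0
  -- pointwise two-sided comparison of the symmetrised integrand with 2·w₁w₂
  have hpt : ∀ z : Ω × Ω,
      2 * Real.exp (-s₂) * ((χ z.1 * Real.exp (F₀ z.1)) * (χ z.2 * Real.exp (F₀ z.2)))
        ≤ (χ z.1 * Real.exp (Fp z.1)) * (χ z.2 * Real.exp (Fm z.2)) + (χ z.1 * Real.exp (Fm z.1)) * (χ z.2 * Real.exp (Fp z.2))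
      ∧ (χ z.1 * Real.exp (Fp z.1)) * (χ z.2 * Real.exp (Fm z.2)) + (χ z.1 * Real.exp (Fm z.1)) * (χ z.2 * Real.exp (Fp z.2))
        ≤ 2 * (Real.exp s₂ * Real.cosh (2 * s₁)) * ((χ z.1 * Real.exp (F₀ z.1)) * (χ z.2 * Real.exp (F₀ z.2))) := by
    intro z
    by_cases hχ1 : χ z.1 = 0
    · simp [hχ1]
    by_cases hχ2 : χ z.2 = 0
    · simp [hχ2]
    have hcc : 0 ≤ χ z.1 * χ z.2 := mul_nonneg (h0 _) (h0 _)
    -- rewrite everything as χ₁χ₂·exp(…)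
    have eA : (χ z.1 * Real.exp (Fp z.1)) * (χ z.2 * Real.exp (Fm z.2))
        = (χ z.1 * χ z.2) * Real.exp (Fp z.1 + Fm z.2) := by rw [Real.exp_add]; ring
    have eB : (χ z.1 * Real.exp (Fm z.1)) * (χ z.2 * Real.exp (Fp z.2))
        = (χ z.1 * χ z.2) * Real.exp (Fm z.1 + Fp z.2) := by rw [Real.exp_add]; ring
    have e0 : (χ z.1 * Real.exp (F₀ z.1)) * (χ z.2 * Real.exp (F₀ z.2))
        = (χ z.1 * χ z.2) * Real.exp (F₀ z.1 + F₀ z.2) := by rw [Real.exp_add]; ring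
    rw [eA, eB, e0]
    have h21 := abs_le.1 (h2 z.1 hχ1)
    have h22 := abs_le.1 (h2 z.2 hχ2)
    have h11 := abs_le.1 (h1 z.1 hχ1)
    have h12 := abs_le.1 (h1 z.2 hχ2)
    constructor
    · -- lower: AM–GM and (F₊ + F₋)/2 ≥ F₀ − s₂/2 at both points
      have hag := two_exp_half_le (Fp z.1 + Fm z.2) (Fm z.1 + Fp z.2)
      have hmid : -s₂ + (F₀ z.1 + F₀ z.2) ≤ (Fp z.1 + Fm z.2 + (Fm z.1 + Fp z.2)) / 2 := by linarith
      have hexp : Real.exp (-s₂) * Real.exp (F₀ z.1 + F₀ z.2) ≤ Real.exp ((Fp z.1 + Fm z.2 + (Fm z.1 + Fp z.2)) / 2) := by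
        rw [← Real.exp_add]; exact Real.exp_le_exp.2 hmid
      nlinarith [Real.exp_nonneg (-s₂), Real.exp_nonneg (F₀ z.1 + F₀ z.2)]
    · -- upper: a_i ≤ b_i + s₂ and cosh(b₁ − b₂) ≤ cosh(2s₁), b = F₀ − F₋
      have hsum : Real.exp (Fp z.1 + Fm z.2) + Real.exp (Fm z.1 + Fp z.2)
          ≤ Real.exp s₂ * Real.exp (F₀ z.1 + F₀ z.2) *
            (Real.exp ((F₀ z.1 - Fm z.1) - (F₀ z.2 - Fm z.2)) + Real.exp ((F₀ z.2 - Fm z.2) - (F₀ z.1 - Fm z.1))) := by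
        have u1 : Fp z.1 + Fm z.2 ≤ s₂ + (F₀ z.1 + F₀ z.2) + ((F₀ z.1 - Fm z.1) - (F₀ z.2 - Fm z.2)) := by linarith
        have u2 : Fm z.1 + Fp z.2 ≤ s₂ + (F₀ z.1 + F₀ z.2) + ((F₀ z.2 - Fm z.2) - (F₀ z.1 - Fm z.1)) := by linarith
        have e1 : Real.exp (s₂ + (F₀ z.1 + F₀ z.2) + ((F₀ z.1 - Fm z.1) - (F₀ z.2 - Fm z.2)))
            = Real.exp s₂ * Real.exp (F₀ z.1 + F₀ z.2) * Real.exp ((F₀ z.1 - Fm z.1) - (F₀ z.2 - Fm z.2)) := by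
          rw [Real.exp_add, Real.exp_add]
        have e2 : Real.exp (s₂ + (F₀ z.1 + F₀ z.2) + ((F₀ z.2 - Fm z.2) - (F₀ z.1 - Fm z.1)))
            = Real.exp s₂ * Real.exp (F₀ z.1 + F₀ z.2) * Real.exp ((F₀ z.2 - Fm z.2) - (F₀ z.1 - Fm z.1)) := by
          rw [Real.exp_add, Real.exp_add]
        have v1 := Real.exp_le_exp.2 u1
        have v2 := Real.exp_le_exp.2 u2
        rw [e1] at v1
        rw [e2] at v2
        linarith
      have hcosh : Real.exp ((F₀ z.1 - Fm z.1) - (F₀ z.2 - Fm z.2)) + Real.exp ((F₀ z.2 - Fm z.2) - (F₀ z.1 - Fm z.1))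
          ≤ 2 * Real.cosh (2 * s₁) := by
        have e : Real.exp ((F₀ z.1 - Fm z.1) - (F₀ z.2 - Fm z.2)) + Real.exp ((F₀ z.2 - Fm z.2) - (F₀ z.1 - Fm z.1))
            = 2 * Real.cosh ((F₀ z.1 - Fm z.1) - (F₀ z.2 - Fm z.2)) := by
          rw [Real.cosh_eq]
          have : -((F₀ z.1 - Fm z.1) - (F₀ z.2 - Fm z.2)) = (F₀ z.2 - Fm z.2) - (F₀ z.1 - Fm z.1) := by ring
          rw [this]; ring
        rw [e]
        have hle : Real.cosh ((F₀ z.1 - Fm z.1) - (F₀ z.2 - Fm z.2)) ≤ Real.cosh (2 * s₁) := by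
          rw [Real.cosh_le_cosh]
          have hs : 0 ≤ s₁ := (abs_nonneg _).trans (h1 z.1 hχ1)
          rw [abs_of_nonneg (by linarith : 0 ≤ 2 * s₁)]
          calc |(F₀ z.1 - Fm z.1) - (F₀ z.2 - Fm z.2)| ≤ |F₀ z.1 - Fm z.1| + |F₀ z.2 - Fm z.2| := abs_sub _ _
            _ ≤ s₁ + s₁ := add_le_add (h1 z.1 hχ1) (h1 z.2 hχ2)
            _ = 2 * s₁ := by ring
        linarith
      have hE : 0 ≤ Real.exp s₂ * Real.exp (F₀ z.1 + F₀ z.2) := mul_nonneg (Real.exp_nonneg _) (Real.exp_nonneg _)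
      nlinarith [mul_le_mul_of_nonneg_left hcosh hE]
  -- integrate the two pointwise bounds over μ × μ
  have hlow : 2 * Real.exp (-s₂) * (I₀ * I₀) ≤ Ip * Im + Im * Ip := by
    rw [hPM, hMP, h00, ← integral_add hIpm hImp, ← integral_const_mul]
    exact integral_mono (hI00.const_mul _) (hIpm.add hImp) fun z => (hpt z).1
  have hupp : Ip * Im + Im * Ip ≤ 2 * (Real.exp s₂ * Real.cosh (2 * s₁)) * (I₀ * I₀) := by
    rw [hPM, hMP, h00, ← integral_add hIpm hImp, ← integral_const_mul]
    exact integral_mono (hIpm.add hImp) (hI00.const_mul _) fun z => (hpt z).2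
  have hprod_low : Real.exp (-s₂) * (I₀ * I₀) ≤ Ip * Im := by nlinarith
  have hprod_upp : Ip * Im ≤ Real.exp s₂ * Real.cosh (2 * s₁) * (I₀ * I₀) := by nlinarith
  -- positivity of the three integrals
  have hIp0 : 0 ≤ Ip := integral_nonneg fun ω => mul_nonneg (h0 ω) (Real.exp_nonneg _)
  have hIm0 : 0 ≤ Im := integral_nonneg fun ω => mul_nonneg (h0 ω) (Real.exp_nonneg _)
  have hPpos : 0 < Ip * Im := lt_of_lt_of_le (mul_pos (Real.exp_pos _) (mul_pos hpos hpos)) hprod_low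
  have hIp : 0 < Ip := by
    rcases hIp0.lt_or_eq with h | h
    · exact h
    · rw [← h, zero_mul] at hPpos; exact absurd hPpos (lt_irrefl 0)
  have hIm : 0 < Im := by
    rcases hIm0.lt_or_eq with h | h
    · exact h
    · rw [← h, mul_zero] at hPpos; exact absurd hPpos (lt_irrefl 0)
  -- take logarithms
  have hlog : Real.log Ip - 2 * Real.log I₀ + Real.log Im = Real.log (Ip * Im / (I₀ * I₀)) := by
    rw [Real.log_div (mul_pos hIp hIm).ne' (mul_pos hpos hpos).ne', Real.log_mul hIp.ne' hIm.ne',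
      Real.log_mul hpos.ne' hpos.ne']
    ring
  rw [hlog, abs_le]
  have hq_low : Real.exp (-s₂) ≤ Ip * Im / (I₀ * I₀) := by
    rw [le_div_iff₀ (mul_pos hpos hpos)]; exact hprod_low
  have hq_upp : Ip * Im / (I₀ * I₀) ≤ Real.exp s₂ * Real.cosh (2 * s₁) := by
    rw [div_le_iff₀ (mul_pos hpos hpos)]; exact hprod_upp
  have hqpos : 0 < Ip * Im / (I₀ * I₀) := div_pos (mul_pos hIp hIm) (mul_pos hpos hpos)
  constructor
  · have h := Real.log_le_log (Real.exp_pos _) hq_low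
    rw [Real.log_exp] at h
    have hs : 0 ≤ 2 * s₁ ^ 2 := by positivity
    linarith
  · have h := Real.log_le_log hqpos hq_upp
    have hc : Real.log (Real.exp s₂ * Real.cosh (2 * s₁)) ≤ s₂ + 2 * s₁ ^ 2 := by
      rw [Real.log_mul (Real.exp_pos _).ne' (Real.cosh_pos _).ne', Real.log_exp]
      have hch : Real.cosh (2 * s₁) ≤ Real.exp ((2 * s₁) ^ 2 / 2) := Real.cosh_le_exp_half_sq _
      have hl := Real.log_le_log (Real.cosh_pos _) hch
      rw [Real.log_exp] at hl
      nlinarith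
    linarith

end Raw

/-! ## §2. On the body: second differences in the last coupling and in an older coupling -/

section Body

variable {X : Type*} (D : FluctData X)

/-- **(S2-last) SECOND DIFFERENCES IN THE LAST COUPLING**: for three couplings `g₋, g₀, g₊` of the SAME step datum at `U`, with the
exponent's first and second differences on the support of `χ_U` bounded by `s₁`, `s₂`
(`|F(g₀) − F(g₋)| ≤ s₁`, `|F(g₊) − 2F(g₀) + F(g₋)| ≤ s₂`), integrable integrands and a positive middle integral:
`|𝐄^{(k+1)}(g₊,U) − 2𝐄^{(k+1)}(g₀,U) + 𝐄^{(k+1)}(g₋,U)| ≤ s₂ + 2s₁²` — with a C² exponent (`s₁ = L₁d`, `s₂ = L₂d²` at spacing `d`):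
`≤ (L₂ + 2L₁²)d²`, the variance-formula bound of `B12Eq213SecondOrderCoupling` WITHOUT derivatives.
[cite: Balaban1987RG1, (2.13) p.268 and p.263 (clause before (1.18))] -/
theorem abs_secondDiff_newTerm_coupling_le {gm g₀ gp : ℝ} {U : X} {s₁ s₂ : ℝ}
    (him : Integrable (D.integrand gm U) (D.μ U)) (hi0 : Integrable (D.integrand g₀ U) (D.μ U))
    (hip : Integrable (D.integrand gp U) (D.μ U)) (hpos : 0 < D.integral g₀ U)
    (h1 : ∀ B, D.χ U B ≠ 0 → |D.exponent g₀ U B - D.exponent gm U B| ≤ s₁)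
    (h2 : ∀ B, D.χ U B ≠ 0 → |D.exponent gp U B - 2 * D.exponent g₀ U B + D.exponent gm U B| ≤ s₂) :
    |D.newTerm gp U - 2 * D.newTerm g₀ U + D.newTerm gm U| ≤ s₂ + 2 * s₁ ^ 2 :=
  abs_secondDiff_log_integral_le (μ := D.μ U) (χ := D.χ U) (Fm := D.exponent gm U) (F₀ := D.exponent g₀ U)
    (Fp := D.exponent gp U) (D.χ_nonneg U) him hi0 hip hpos h1 h2

/-- **(S2-old) THE SECOND-ORDER STEP INEQUALITY THROUGH THE CURLY BRACKET**: three curly brackets `{…}₋, {…}₀, {…}₊` (three old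
actions, e.g. one old action under three histories differing in ONE older coupling) in the SAME step datum at the same coupling `g`,
with `|{…}₀ − {…}₋| ≤ s₁` and `|{…}₊ − 2{…}₀ + {…}₋| ≤ s₂` on the support of `χ_U`, integrable integrands and a positive middle integral:
`|𝐄₊^{(k+1)}(g,U) − 2𝐄₀^{(k+1)}(g,U) + 𝐄₋^{(k+1)}(g,U)| ≤ s₂ + 2s₁²` — «linear channel `s₂` + variance channel `2s₁²`», the body-level
vertex-free input of a second-order history recursion. [cite: Balaban1987RG1, (2.12)–(2.13) p.268 and §0 p.256] -/
theorem abs_secondDiff_newTerm_withQ_le (Qm Qp : ℝ → X → D.𝓑 → ℝ) {g : ℝ} {U : X} {s₁ s₂ : ℝ}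
    (him : Integrable (FluctData.integrand { D with Q := Qm } g U) (D.μ U))
    (hi0 : Integrable (D.integrand g U) (D.μ U))
    (hip : Integrable (FluctData.integrand { D with Q := Qp } g U) (D.μ U)) (hpos : 0 < D.integral g U)
    (h1 : ∀ B, D.χ U B ≠ 0 → |D.Q g U B - Qm g U B| ≤ s₁)
    (h2 : ∀ B, D.χ U B ≠ 0 → |Qp g U B - 2 * D.Q g U B + Qm g U B| ≤ s₂) :
    |FluctData.newTerm { D with Q := Qp } g U - 2 * D.newTerm g U + FluctData.newTerm { D with Q := Qm } g U|
      ≤ s₂ + 2 * s₁ ^ 2 :=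
  abs_secondDiff_log_integral_le (μ := D.μ U) (χ := D.χ U) (Fm := FluctData.exponent { D with Q := Qm } g U)
    (F₀ := D.exponent g U) (Fp := FluctData.exponent { D with Q := Qp } g U) (D.χ_nonneg U) him hi0 hip hpos
    (fun B hB => by simpa [FluctData.exponent_apply, add_sub_add_left_eq_sub] using h1 B hB)
    (fun B hB => by
      have h := h2 B hB
      have e : FluctData.exponent { D with Q := Qp } g U B - 2 * D.exponent g U B + FluctData.exponent { D with Q := Qm } g U B
          = Qp g U B - 2 * D.Q g U B + Qm g U B := by
        simp only [FluctData.exponent_apply]; ring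
      rw [e]; exact h)

end Body

end Literature.MathematicalPhysics.QuantumFieldTheory.Balaban1983to89.B12Eq213SecondDifference
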